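import Literature.Probability.Percolation.CriticalTwoArmsPersistence
import Summits.CriticalPhenomena.PercolationContinuityZ3.Theorems.PercNearOneGluingNoHeavyLowerTailCSHTheoremOne
import HarnessLib

/-!
# At criticality, at every scale: annulus blocking or two-arms — with an explicit constant
# (the van den Berg–van Engelenburg dichotomy at `p_c(ℤ^d)`, made unconditional and scale-uniform)

builds on p205010 (kernel theorem, internal audit signed; external expert review pending)

QUANT lane (post-continuity programme, LANE 1), rung R3″ of `run/shared/lean/prim/quant/LADDER.md`, lead seat
`prim-quant-lead`. Helper file for the crux `X_B = PercAnnulusCrossing.CritAnnulusNonCrossing`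
(stmt-CriticalPhenomena-0846, `--supports`). No definitions, no named facts, no sorries.

Write `P = P_{p_c(ℤ^d)}` (bond percolation on `zdGraph d` at `criticalProbI d`), `B(n) = box d n = [-n,n]^d`, and, in
the Kesten–Zhang block geometry of `Literature/Probability/Percolation/KestenZhangBlocks.lean` /
`CriticalTwoArmsPersistenceBlocks.lean`:
* `BLOCK(N₀) := (KestenZhang.farArmO N₀)ᶜ` — NO vertex of `B(N₀)` is joined inside `B(7N₀+3)` to the inner vertex
  boundary of `B(7N₀+3)`: the ANNULUS-BLOCKING event "`B(N₀) ↮ ∂ⁱⁿB(7N₀+3)` in `B(7N₀+3)`" (aspect ratio 7), the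
  complement of the box-crossing event of `PercAnnulusCrossing.CritCrossingPolyDecay` at `(n, m) = (N₀, 7N₀+3)`;
* `TWOARMS(N₀) := KestenZhang.TwoArms N₀` — Grimmett's clause (b): two vertices of the core `B(3N₀+1)` are joined
  inside `B̃ = B(5N₀+2)` to `∂B̃` but not to each other inside `B̃` (linear-scale LOCAL NON-UNIQUENESS).

## Results

* `critical_blocking_add_twoArms_gt` — **for every `d ≥ 2` and EVERY scale `N₀`:
  `P(BLOCK(N₀)) + P(TWOARMS(N₀)) > δ_d ^ (7^d)`**, `δ_d = KestenZhang.critTwoArmsDelta d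
  = 1 / (2 (7^d + 2) (2 (3^d + 1)²)^{7^d})` (for `d = 3`: `δ_3 = 1/(690 · 1568^{343})`, threshold `δ_3^{343}`).
* `critical_blocking_or_twoArms` — hence `P(BLOCK(N₀)) > δ_d^{7^d}/2` or `P(TWOARMS(N₀)) > δ_d^{7^d}/2`.
* `critical_glueGood_defect` — the bad event of the origin block of the same-density `★`-Peierls criterion has
  probability `> δ_d^{7^d}` at `p_c`, at every scale.

Proof: the tree's SAME-DENSITY finite-size criterion `KestenZhang.theta_pos_of_real_compl_glueGoodO_le`
("`P_p((glueGoodO N₀)ᶜ) ≤ δ_d^{7^d}` at ONE scale ⇒ `θ(p) > 0`", Observation 8 of van den Berg–van Engelenburg +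
a `★`-Peierls count, no sprinkling) applied AT `p = p_c`, where `θ(p_c) = 0` by p205010
(`CSH.percolationContinuity_allDimensions`, Kozma–Nitzan Thm 6 + the tree's proof of their Conjecture 3); and
`(glueGoodO N₀)ᶜ ⊆ BLOCK(N₀) ∪ TWOARMS(N₀)` (`KestenZhang.real_compl_glueGoodO_le`).  Before p205010 the same
argument gave the bound only at some `p' < p_c` near `p_c` (continuity of a local event), i.e. `≥` with `N₀`-dependent
bookkeeping; the strict, every-scale form at `p_c` itself is what `θ(p_c) = 0` adds.

Reading (numbers, not adjectives).  This is an RSW-type NON-TRIVIALITY statement at criticality, uniform in the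
scale, with an explicit (astronomically small) constant: at every scale, either closed dual surfaces block the
aspect-7 annulus with probability `> δ_d^{7^d}/2`, or two locally disjoint large clusters coexist with that
probability.  It does NOT say which alternative holds.  In `d = 3` both are expected to carry probability of order one
at every scale; for `d > 6` the blocking alternative fails (`Literature.Barriers.CriticalPhenomena.SpanningClustersAboveSix`:
`P_{p_c}(B(n) ↔ ∂B(2n)) → 1`) and the two-arms alternative carries everything.  Consequently the dichotomy alone
cannot yield the blocking leaf `X_B` (hence no one-arm RATE); what it yields is recorded in
`critical_cesaroBlocking_of_twoArms_small`'s docstring-level remark in LADDER.md R3″ (a conditional rate under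
local uniqueness at most scales — a hypothesis expected to be false in `d = 3`, van den Berg–van Engelenburg Prop. 2).
[cite: VandenbergVanengelenburg2022, §3 Lemma 6, Definition 7, Observation 8] [cite: GrimmettPercolation1999, §8.6 p. 223 (clause (b))]
-/

noncomputable section

namespace Summit.CriticalPhenomena.PercolationContinuityZ3.Theorems

open MeasureTheory
open Literature.Probability.Percolation Literature.Probability.LatticeModels
open Literature.Probability.Percolation.KestenZhang

/-- **The `★`-Peierls bad event is not rare at `p_c`, at any scale** (`d ≥ 2`): for every `N₀`,
`P_{p_c}((glueGoodO N₀)ᶜ) > δ_d^{7^d}`, `δ_d = critTwoArmsDelta d`.  Contrapositive of the same-density criterion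
`KestenZhang.theta_pos_of_real_compl_glueGoodO_le` at `p = p_c`, using `θ(p_c) = 0`
(`CSH.percolationContinuity_allDimensions`, p205010).  builds on p205010 (kernel theorem, internal audit signed;
external expert review pending). [cite: VandenbergVanengelenburg2022, §3 Lemma 6 (proof: Observation 8 and the domination step)] -/
theorem critical_glueGood_defect {d : ℕ} (hd : 2 ≤ d) (N₀ : ℕ) :
    critTwoArmsDelta d ^ 7 ^ d <
      (bondPercolation (zdGraph d) (criticalProbI d)).real (glueGoodO (d := d) N₀)ᶜ := by
  by_contra h
  push Not at h
  have hθ : 0 < theta (zdGraph d) (0 : Site d) (criticalProbI d) :=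
    theta_pos_of_real_compl_glueGoodO_le hd (criticalProbI d) N₀ h
  have h0 : theta (zdGraph d) (0 : Site d) (criticalProbI d) = 0 :=
    CSH.percolationContinuity_allDimensions d hd
  exact hθ.ne' h0

/-- **At criticality, at every scale: blocking plus two-arms exceeds an explicit constant** (`d ≥ 2`): for every
`N₀`, `P_{p_c}(B(N₀) ↮ ∂ⁱⁿB(7N₀+3) in B(7N₀+3)) + P_{p_c}(TwoArms N₀) > δ_d^{7^d}`, where the first event is
`(farArmO N₀)ᶜ` and `δ_d = critTwoArmsDelta d = 1/(2(7^d+2)(2(3^d+1)²)^{7^d})` (`d = 3`: `δ_3^{343}`,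
`δ_3 = 1/(690·1568^{343})`).  From `critical_glueGood_defect` and `(glueGoodO N₀)ᶜ ⊆ (farArmO N₀)ᶜ ∪ TwoArms N₀`
(`KestenZhang.real_compl_glueGoodO_le`).  builds on p205010 (kernel theorem, internal audit signed; external expert
review pending). [cite: VandenbergVanengelenburg2022, §3 Lemma 6 and Definition 7] -/
theorem critical_blocking_add_twoArms_gt {d : ℕ} (hd : 2 ≤ d) (N₀ : ℕ) :
    critTwoArmsDelta d ^ 7 ^ d <
      (bondPercolation (zdGraph d) (criticalProbI d)).real (farArmO (d := d) N₀)ᶜ +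
        (bondPercolation (zdGraph d) (criticalProbI d)).real (TwoArms (d := d) N₀) :=
  (critical_glueGood_defect hd N₀).trans_le (real_compl_glueGoodO_le (criticalProbI d) N₀)

/-- **The dichotomy form**: at `p_c(ℤ^d)`, `d ≥ 2`, at every scale `N₀`, either the annulus `B(7N₀+3) ∖ B(N₀)` is
BLOCKED (no vertex of `B(N₀)` reaches `∂ⁱⁿB(7N₀+3)` inside `B(7N₀+3)`) with probability `> δ_d^{7^d}/2`, or the
two-arms event `TwoArms N₀` (two locally disjoint boundary-reaching clusters in `B(5N₀+2)`) has probability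
`> δ_d^{7^d}/2`.  builds on p205010 (kernel theorem, internal audit signed; external expert review pending).
[cite: VandenbergVanengelenburg2022, §3 Lemma 6] -/
theorem critical_blocking_or_twoArms {d : ℕ} (hd : 2 ≤ d) (N₀ : ℕ) :
    critTwoArmsDelta d ^ 7 ^ d / 2 < (bondPercolation (zdGraph d) (criticalProbI d)).real (farArmO (d := d) N₀)ᶜ ∨
      critTwoArmsDelta d ^ 7 ^ d / 2 < (bondPercolation (zdGraph d) (criticalProbI d)).real (TwoArms (d := d) N₀) := by
  by_contra h
  push Not at h
  have := critical_blocking_add_twoArms_gt hd N₀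
  linarith [h.1, h.2]

/-- **`d = 3` instance** (the QUANT lane's dimension): at `p_c(ℤ³)`, for every `N₀`,
`P(B(N₀) ↮ ∂ⁱⁿB(7N₀+3) in B(7N₀+3)) + P(TwoArms N₀) > (critTwoArmsDelta 3)^{343}`.
builds on p205010 (kernel theorem, internal audit signed; external expert review pending).
[cite: VandenbergVanengelenburg2022, §3 Lemma 6] -/
theorem critical_blocking_add_twoArms_gt_three (N₀ : ℕ) :
    critTwoArmsDelta 3 ^ 343 <
      (bondPercolation (zdGraph 3) (criticalProbI 3)).real (farArmO (d := 3) N₀)ᶜ +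
        (bondPercolation (zdGraph 3) (criticalProbI 3)).real (TwoArms (d := 3) N₀) := by
  have h := critical_blocking_add_twoArms_gt (d := 3) (by norm_num) N₀
  norm_num at h
  exact h

end Summit.CriticalPhenomena.PercolationContinuityZ3.Theorems

end
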